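import Literature.Computability.ImplicitComplexity.STAEncConf
import Literature.Computability.Complexity.FlatPrograms
import HarnessLib

/-!
# GMR08 completeness infrastructure, VII: one machine step as a closed `STA` term

Support file 7 for the completeness half of
`Literature.Computability.ImplicitComplexity.STACapturesP` (GMR08 Thm. 3.9): the transition
term. GMR (after Gaboardi–Ronchi Della Rocca 2007) decompose a step into `Dec` (each tape half
through the delay line `F[c]`, exposing top symbol and a spare cell constructor) and `Com` (a
case analysis on the transition, with closed branches rebuilding the configuration). Here the
machine is a flat program `FP` over `nK` stacks (`FlatProg.step`: `goto j | push k a j | pop k t`,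
the tree's universal-machine model), the configuration carries one more stack — the RESERVOIR of
pre-allocated blank cells supplying the cell constructor a `push` needs (GMR's `Init` pre-allocates
the whole tape the same way) — and `Dec`/`Com` are fused:

* `Step ≐ λs c₁ c₂. let s F[c₁] F[c₂] be f₀,…,f_{KS-1},p in (p Br₀ ⋯ Br_H) (f₀ initD) ⋯ (f_{KS-1} initD)`
  with the closed branches `brInstr FP[pc]?` (`brGoto`, `brPush`, `brPop`; an instruction on a
  stack index `≥ nK` acts on the length-`nK` list configuration as a jump, and is compiled so);
* `TCfg`, `stepT` — configurations with tagged cells (which constructor built the cell) and the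
  reservoir, and their step; `encConf` — their encoding `λc₁c₂.⟨stacks…, pc⟩`;
* **`reduces_app_Step`**: `Step (encConf T) →β* encConf (stepT T)` whenever the reservoir is
  non-empty and all symbols are `< NS`;
* the typing `⊢ Step : Conf ⊸ Conf` (`Conf ≐ ∀α.!ᵐX ⊸ !ᵖX ⊸ (St^{KS} ⊗ E_{H+1})`, for all
  levels `m, p` of the two constructors; GMR: "`Tr : ATM_i ⊸ ATM_i` for every `i`") is
  `HTz.Step` in the sequel `STAEncStepTy.lean`.

## References

* [GaboardiMarionRonchidellarocca2008] GMR08 §3.2, Thm. 3.9; M. Gaboardi, J.-Y. Marion,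
  S. Ronchi Della Rocca, ACM TOCL 13 (2012) §5 (`Dec`, `Com`, `Tr`); [AroraBarakCC2009] §1.4
  (machines as programs: the flat step `FlatProg.step` simulated here).
-/

namespace Literature.Computability.ImplicitComplexity

namespace STA

namespace Sim

open Literature.Computability.Complexity.FlatProg (Instr Prog tblIdx)

/-! ### Configurations with tagged cells and a reservoir -/

/-- Term-side configurations: program counter and the stacks `0, …, nK - 1` of the machine plus
the reservoir (index `nK`), as lists of cells `(tag, symbol)` (top first), the tag recording
which of the two cell constructors built the cell. [cite: GaboardiMarionRonchidellarocca2008, §3.2] -/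
structure TCfg where
  /-- program counter -/
  pc : ℕ
  /-- the stacks (indices `< nK`) and the reservoir (index `nK`) -/
  stk : ℕ → List (Bool × ℕ)

variable (NS nK : ℕ) (FP : Prog)

/-- The two cell constructors under `λc₁ c₂`: `c₁` (tag `true`) is the variable `1`, `c₂` the
variable `0`. [folklore] -/
def cvar : Bool → Term
  | true => .var 1
  | false => .var 0

/-- The body `⟨stack₀, …, stack_{nK}, pc⟩` of a configuration, cell constructors `C`.
[cite: GaboardiMarionRonchidellarocca2008, §3.2] -/
def bodyT (C : Bool → Term) (T : TCfg) : Term :=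
  Term.tuple (((List.range (nK + 1)).map fun i => encStack NS C (T.stk i)) ++ [pcT FP.length T.pc])

/-- **The encoding of a configuration** `λc₁ c₂. ⟨stack₀, …, stack_{nK}, pc⟩`.
[cite: GaboardiMarionRonchidellarocca2008, §3.2 ("`λc.⟨cb₀ˡ ∘ ⋯, cb₀ʳ ∘ ⋯, ⟨Q,k⟩⟩`")] -/
def encConf (T : TCfg) : Term := .lam (.lam (bodyT NS nK FP cvar T))

/-- Pushing symbol `a` on stack `k` with the top reservoir cell (the push is dropped if the
reservoir is empty — which the simulation never lets happen). [cite: GaboardiMarionRonchidellarocca2008, §3.2] -/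
def pushRes (S : ℕ → List (Bool × ℕ)) (k a : ℕ) : ℕ → List (Bool × ℕ) :=
  match S nK with
  | [] => S
  | (o, _) :: res => Function.update (Function.update S k ((o, a) :: S k)) nK res

/-- **The step on term-side configurations** (the flat step `FlatProg.step` with the reservoir
bookkeeping; instructions on stack indices `≥ nK` are jumps, as on length-`nK` configurations).
[cite: GaboardiMarionRonchidellarocca2008, §3.2; AroraBarakCC2009, §1.4] -/
def stepT (T : TCfg) : TCfg :=
  match FP[T.pc]? with
  | none => T
  | some (.goto j) => ⟨j, T.stk⟩
  | some (.push k a j) => if k < nK then ⟨j, pushRes nK T.stk k a⟩ else ⟨j, T.stk⟩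
  | some (.pop k t) =>
      if k < nK then ⟨t.getD (tblIdx ((T.stk k).head?.map Prod.snd)) 0, Function.update T.stk k (T.stk k).tail⟩
      else ⟨t.getD 0 0, T.stk⟩

/-- Well-formed configurations: every symbol is `< NS`. [folklore] -/
def TCfg.SymOK (T : TCfg) : Prop := ∀ i ≤ nK, ∀ oa ∈ T.stk i, oa.2 < NS

/-! ### The branches -/

/-- A decomposed stack restored: `D commitT`. [cite: GaboardiMarionRonchidellarocca2008, §3.2] -/
def restore (D : Term) : Term := .app D (commitT NS)

/-- The body of `brGoto j` over accessors `Dv i` for the decomposed stacks. [folklore] -/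
def gotoBody (j : ℕ) (Dv : ℕ → Term) : Term :=
  Term.tuple (((List.range (nK + 1)).map fun i => restore NS (Dv i)) ++ [pcT FP.length j])

/-- `brGoto j ≐ λD₀…D_{nK}. ⟨restore D₀, …, restore D_{nK}, j⟩`. [cite: GaboardiMarionRonchidellarocca2008, §3.2 (`Com`)] -/
def brGoto (j : ℕ) : Term := Term.lams (nK + 1) (gotoBody NS nK FP j fun i => .var (nK - i))

/-- The body of `brPush k a j` over accessors: stack `k` gets the cell `Hh a` on top of its
restoration, the reservoir becomes `G`. [folklore] -/
def pushBody (k a j : ℕ) (Dv : ℕ → Term) (G Hh : Term) : Term :=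
  Term.tuple (((List.range (nK + 1)).map fun i =>
    if i = k then .lam (.app (.app (Hh.rename Nat.succ) (symT NS a)) (.app ((restore NS (Dv k)).rename Nat.succ) (.var 0)))
    else if i = nK then G else restore NS (Dv i)) ++ [pcT FP.length j])

/-- `brPush k a j ≐ λD⃗. let D_{nK} be g,h,i in ⟨…, λz. h a (restore D_k z), …, g, j⟩`.
[cite: GaboardiMarionRonchidellarocca2008, §3.2 (`Com`, case Right/Left)] -/
def brPush (k a j : ℕ) : Term :=
  Term.lams (nK + 1) (Term.letT 3 (.var 0) (pushBody NS nK FP k a j (fun i => .var (nK - i + 3)) (.var 2) (.var 1)))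

/-- The body of `brPop k t` over accessors: stack `k` becomes `G`, the new program counter is read
off the popped symbol `Iv` through the table `t`. [folklore] -/
def popBody (k : ℕ) (t : List ℕ) (Dv : ℕ → Term) (G Iv : Term) : Term :=
  Term.tuple (((List.range (nK + 1)).map fun i => if i = k then G else restore NS (Dv i)) ++
    [Iv.apps ((List.range (NS + 1)).map fun idx => pcT FP.length (t.getD idx 0))])

/-- `brPop k t ≐ λD⃗. let D_k be g,h,i in ⟨…, g, …, i (t₀) ⋯ (t_NS)⟩`. [cite: GaboardiMarionRonchidellarocca2008, §3.2 (`Com`)] -/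
def brPop (k : ℕ) (t : List ℕ) : Term :=
  Term.lams (nK + 1) (Term.letT 3 (.var (nK - k)) (popBody NS nK FP k t (fun i => .var (nK - i + 3)) (.var 2) (.var 0)))

/-- The branch of an instruction (none = halted: stay). [cite: GaboardiMarionRonchidellarocca2008, §3.2] -/
def brInstr : Option Instr → Term
  | none => brGoto NS nK FP FP.length
  | some (.goto j) => brGoto NS nK FP j
  | some (.push k a j) => if k < nK then brPush NS nK FP k a j else brGoto NS nK FP j
  | some (.pop k t) => if k < nK then brPop NS nK FP k t else brGoto NS nK FP (t.getD 0 0)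

/-- The `H + 1` branches, indexed by the program counter. [cite: GaboardiMarionRonchidellarocca2008, §3.2] -/
def BRS : List Term := (List.range (FP.length + 1)).map fun pc => brInstr NS nK FP FP[pc]?

/-- The continuation of `Step`: `(p BRS) (f₀ initD) ⋯ (f_{nK} initD)`, binders `f₀ … f_{nK} p`. [folklore] -/
def stepBody : Term :=
  ((Term.var 0).apps (BRS NS nK FP)).apps ((List.range (nK + 1)).map fun j => .app (.var (nK + 1 - j)) (initD NS))

/-- **The transition term** `Step ≐ λs c₁ c₂. let (s F[c₁] F[c₂]) be f⃗,p in (p BRS) (f⃗ initD)`.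
[cite: GaboardiMarionRonchidellarocca2008, §3.2 ("`Tr ≐ Com ∘ Dec`")] -/
def Step : Term :=
  Term.lams 3 (Term.letT (nK + 2) ((Term.var 2).apps [F NS (.var 1), F NS (.var 0)]) (stepBody NS nK FP))

/-! ### Substitution through the pieces -/

variable {NS nK FP}

/-- A list lemma: `Forall₂` between two maps of the same list. [folklore] -/
theorem _root_.List.forall₂_map_map {α β γ : Type} {R : β → γ → Prop} {f : α → β} {g : α → γ} :
    ∀ {l : List α}, (∀ x ∈ l, R (f x) (g x)) → List.Forall₂ R (l.map f) (l.map g)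
  | [], _ => List.Forall₂.nil
  | x :: l, h => List.Forall₂.cons (h x (by simp)) (List.forall₂_map_map fun y hy => h y (by simp [hy]))

/-- `restore_substp` (bookkeeping). [folklore] -/
theorem restore_substp (D : Term) (τ : ℕ → Term) : (restore NS D).substp τ = restore NS (D.substp τ) := by
  simp [restore, Term.substp, commitT_substp]

/-- `restore_rename` (bookkeeping). [folklore] -/
theorem restore_rename (D : Term) (ρ : ℕ → ℕ) : (restore NS D).rename ρ = restore NS (D.rename ρ) := by
  rw [Term.rename_eq_substp, restore_substp, ← Term.rename_eq_substp]

/-- Lifting past binders fixes the low variables. [folklore] -/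
theorem _root_.Literature.Computability.ImplicitComplexity.STA.Term.up_iterate_var_lt (τ : ℕ → Term) :
    ∀ {n i : ℕ}, i < n → (Term.up^[n] τ) i = .var i
  | 0, _, h => absurd h (Nat.not_lt_zero _)
  | n + 1, 0, _ => by rw [Function.iterate_succ_apply']; rfl
  | n + 1, i + 1, h => by
    rw [Function.iterate_succ_apply', Term.up_succ, Term.up_iterate_var_lt τ (by omega)]
    rfl

/-- `F[c]` under substitution: only the constructor changes. [folklore] -/
theorem F_substp (Cc : Term) (τ : ℕ → Term) : (F NS Cc).substp τ = F NS (Cc.substp τ) := by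
  simp only [F, Term.substp, Term.letT_substp, Term.tuple_substp, List.map_cons, List.map_nil, Term.up_zero,
    commitBody_substp_up3]
  have e : Term.up^[3] (Term.up (Term.up τ)) = Term.up^[0 + 5] τ := rfl
  rw [e, Term.substp_rename_add Cc τ 0 5, Term.up_iterate_var_lt τ (by omega)]
  rfl

/-- `F_rename` (bookkeeping). [folklore] -/
theorem F_rename (Cc : Term) (ρ : ℕ → ℕ) : (F NS Cc).rename ρ = F NS (Cc.rename ρ) := by
  rw [Term.rename_eq_substp, F_substp, ← Term.rename_eq_substp]

/-- The configuration body under substitution: only the constructors change. [folklore] -/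
theorem bodyT_substp (C : Bool → Term) (T : TCfg) (τ : ℕ → Term) :
    (bodyT NS nK FP C T).substp τ = bodyT NS nK FP (fun o => (C o).substp τ) T := by
  simp only [bodyT, Term.tuple_substp, List.map_append, List.map_map, List.map_cons, List.map_nil, pcT_substp]
  congr 2
  exact List.map_congr_left fun i _ => by simp [encStack_substp]

/-- Encoded configurations are closed. [folklore] -/
theorem encConf_substp (T : TCfg) (τ : ℕ → Term) : (encConf NS nK FP T).substp τ = encConf NS nK FP T := by
  simp only [encConf, Term.substp, bodyT_substp]
  have : (fun o => (cvar o).substp (Term.up (Term.up τ))) = cvar := by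
    funext o; cases o <;> rfl
  rw [this]

/-- `gotoBody_substp` (bookkeeping). [folklore] -/
theorem gotoBody_substp (j : ℕ) (Dv : ℕ → Term) (τ : ℕ → Term) :
    (gotoBody NS nK FP j Dv).substp τ = gotoBody NS nK FP j fun i => (Dv i).substp τ := by
  simp only [gotoBody, Term.tuple_substp, List.map_append, List.map_map, List.map_cons, List.map_nil, pcT_substp]
  congr 2
  exact List.map_congr_left fun i _ => by simp [restore_substp]

/-- `pushBody_substp` (bookkeeping). [folklore] -/
theorem pushBody_substp (k a j : ℕ) (Dv : ℕ → Term) (G Hh : Term) (τ : ℕ → Term) :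
    (pushBody NS nK FP k a j Dv G Hh).substp τ =
      pushBody NS nK FP k a j (fun i => (Dv i).substp τ) (G.substp τ) (Hh.substp τ) := by
  simp only [pushBody, Term.tuple_substp, List.map_append, List.map_map, List.map_cons, List.map_nil, pcT_substp]
  congr 2
  refine List.map_congr_left fun i _ => ?_
  simp only [Function.comp_apply]
  split_ifs
  · simp only [Term.substp, Term.up_zero, symT_substp, restore_substp, restore_rename]
    rw [Term.substp_rename, Term.rename_substp, Term.substp_rename, Term.rename_substp]
    rfl
  · rfl
  · exact restore_substp _ _

/-- `popBody_substp` (bookkeeping). [folklore] -/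
theorem popBody_substp (k : ℕ) (t : List ℕ) (Dv : ℕ → Term) (G Iv : Term) (τ : ℕ → Term) :
    (popBody NS nK FP k t Dv G Iv).substp τ =
      popBody NS nK FP k t (fun i => (Dv i).substp τ) (G.substp τ) (Iv.substp τ) := by
  simp only [popBody, Term.tuple_substp, List.map_append, List.map_map, List.map_cons, List.map_nil,
    Term.substp_apps]
  congr 2
  · refine List.map_congr_left fun i _ => ?_
    simp only [Function.comp_apply]
    split_ifs
    · rfl
    · exact restore_substp _ _
  · congr 2
    exact List.map_congr_left fun i _ => pcT_substp _ _ _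

/-- The branches are closed terms: their bodies only mention the binders. [folklore] -/
theorem brGoto_substp (j : ℕ) (τ : ℕ → Term) : (brGoto NS nK FP j).substp τ = brGoto NS nK FP j := by
  rw [brGoto, Term.substp_lams, gotoBody_substp]
  congr 2
  funext i
  exact Term.up_iterate_var_lt τ (by omega)

/-- `brPush_substp` (bookkeeping). [folklore] -/
theorem brPush_substp (k a j : ℕ) (τ : ℕ → Term) : (brPush NS nK FP k a j).substp τ = brPush NS nK FP k a j := by
  rw [brPush, Term.substp_lams, Term.letT_substp, pushBody_substp]
  have h3 : ∀ i, i < nK + 1 + 3 → (Term.up^[3] (Term.up^[nK + 1] τ)) i = .var i := fun i hi => by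
    rw [← Function.iterate_add_apply]; exact Term.up_iterate_var_lt τ (by omega)
  simp only [Term.substp, Term.up_iterate_var_lt τ (show 0 < nK + 1 by omega), h3 2 (by omega), h3 1 (by omega)]
  congr 4
  funext i
  exact h3 _ (by omega)

/-- `brPop_substp` (bookkeeping). [folklore] -/
theorem brPop_substp (k : ℕ) (t : List ℕ) (τ : ℕ → Term) : (brPop NS nK FP k t).substp τ = brPop NS nK FP k t := by
  rw [brPop, Term.substp_lams, Term.letT_substp, popBody_substp]
  have h3 : ∀ i, i < nK + 1 + 3 → (Term.up^[3] (Term.up^[nK + 1] τ)) i = .var i := fun i hi => by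
    rw [← Function.iterate_add_apply]; exact Term.up_iterate_var_lt τ (by omega)
  simp only [Term.substp, Term.up_iterate_var_lt τ (show nK - k < nK + 1 by omega), h3 2 (by omega), h3 0 (by omega)]
  congr 4
  funext i
  exact h3 _ (by omega)

/-- `brInstr_substp` (bookkeeping). [folklore] -/
theorem brInstr_substp (oi : Option Instr) (τ : ℕ → Term) : (brInstr NS nK FP oi).substp τ = brInstr NS nK FP oi := by
  rcases oi with _ | ⟨j⟩ | ⟨k, a, j⟩ | ⟨k, t⟩ <;> simp only [brInstr]
  · exact brGoto_substp _ _
  · exact brGoto_substp _ _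
  · split_ifs
    · exact brPush_substp _ _ _ _
    · exact brGoto_substp _ _
  · split_ifs
    · exact brPop_substp _ _ _
    · exact brGoto_substp _ _

/-- `BRS_substp` (bookkeeping). [folklore] -/
theorem BRS_substp (τ : ℕ → Term) : (BRS NS nK FP).map (fun B => B.substp τ) = BRS NS nK FP := by
  simp only [BRS, List.map_map]
  exact List.map_congr_left fun pc _ => brInstr_substp _ _

/-- `length_BRS` (bookkeeping). [folklore] -/
@[simp] theorem length_BRS : (BRS NS nK FP).length = FP.length + 1 := by simp [BRS]

/-! ### The run of `Step` on an encoded configuration -/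

/-- The cell constructors of a configuration fed to `Step`: `F[c₁]`, `F[c₂]`. [folklore] -/
theorem cvar_F (o : Bool) : (cvar o).substp (Term.subL [F NS (.var 1), F NS (.var 0)]) = F NS (cvar o) := by
  cases o <;> simp [cvar, Term.substp, Term.subL]

/-- Halted program counters are encoded like `H`. [folklore] -/
theorem pcT_of_le {H pc : ℕ} (h : H ≤ pc) : pcT H pc = pcT H H := by
  simp [pcT, Nat.min_eq_right h]

/-- The first phase: `s F[c₁] F[c₂]` and the `let`, leaving the dispatch spine.
[cite: GaboardiMarionRonchidellarocca2008, §3.2 (`Dec`)] -/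
theorem reduces_step_phase1 (T : TCfg) :
    Reduces (Term.letT (nK + 2) ((encConf NS nK FP T).apps [F NS (.var 1), F NS (.var 0)]) (stepBody NS nK FP))
      (((pcT FP.length T.pc).apps (BRS NS nK FP)).apps
        ((List.range (nK + 1)).map fun i => .app (encStack NS (fun o => F NS (cvar o)) (T.stk i)) (initD NS))) := by
  -- `(λc₁c₂. body) F₁ F₂ →* body[F₁, F₂]`
  have h1 : Reduces ((encConf NS nK FP T).apps [F NS (.var 1), F NS (.var 0)])
      (bodyT NS nK FP (fun o => F NS (cvar o)) T) := by
    have := reduces_apps_lams 2 (bodyT NS nK FP cvar T) [F NS (.var 1), F NS (.var 0)] rfl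
    rw [bodyT_substp] at this
    simp only [cvar_F] at this
    exact this
  refine (Reduces.letT _ h1 Relation.ReflTransGen.refl).trans ?_
  -- the `let`
  have h2 := reduces_letT_tuple (((List.range (nK + 1)).map fun i => encStack NS (fun o => F NS (cvar o)) (T.stk i)) ++
      [pcT FP.length T.pc]) (stepBody NS nK FP) (n := nK + 2) (by simp)
  -- compute the substitution in the dispatch spine
  set comps := ((List.range (nK + 1)).map fun i => encStack NS (fun o => F NS (cvar o)) (T.stk i)) ++ [pcT FP.length T.pc]
    with hcomps
  have e0 : Term.subL comps 0 = pcT FP.length T.pc := by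
    rw [Term.subL, dif_pos (by simp [hcomps])]
    simp [hcomps, List.getElem_append_right]
  have ei : ∀ i < nK + 1, Term.subL comps (nK + 1 - i) = encStack NS (fun o => F NS (cvar o)) (T.stk i) := by
    intro i hi
    rw [Term.subL, dif_pos (by simp [hcomps])]
    have : comps.length - 1 - (nK + 1 - i) = i := by simp [hcomps]; omega
    simp only [List.get_eq_getElem, this]
    rw [List.getElem_append_left (by simp; omega)]
    simp
  have e : (stepBody NS nK FP).substp (Term.subL comps) = ((pcT FP.length T.pc).apps (BRS NS nK FP)).apps
      ((List.range (nK + 1)).map fun i => .app (encStack NS (fun o => F NS (cvar o)) (T.stk i)) (initD NS)) := by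
    simp only [stepBody, Term.substp_apps, Term.substp, BRS_substp, e0, List.map_map]
    congr 1
    refine List.map_congr_left fun i hi => ?_
    rw [List.mem_range] at hi
    simp only [Function.comp_apply, Term.substp, initD_substp, ei i hi]
  rw [e] at h2
  exact h2

/-- The dispatch spine is untouched by substitutions lifted past the binders of the `let`. [folklore] -/
theorem stepBody_substp_up (σ : ℕ → Term) : (stepBody NS nK FP).substp (Term.up^[nK + 2] σ) = stepBody NS nK FP := by
  simp only [stepBody, Term.substp_apps, Term.substp, BRS_substp, List.map_map,
    Term.up_iterate_var_lt σ (show 0 < nK + 2 by omega)]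
  congr 1
  refine List.map_congr_left fun j hj => ?_
  rw [List.mem_range] at hj
  simp only [Function.comp_apply, Term.substp, initD_substp, Term.up_iterate_var_lt σ (show nK + 1 - j < nK + 2 by omega)]

/-- `Step` is closed: substitutions do nothing. [folklore] -/
theorem Step_substp (τ : ℕ → Term) : (Step NS nK FP).substp τ = Step NS nK FP := by
  simp only [Step, Term.substp_lams, Term.letT_substp, Term.substp_apps, List.map_cons, List.map_nil, F_substp, Term.substp]
  rw [show Term.up^[3] τ = Term.up (Term.up (Term.up τ)) from rfl]
  simp only [Term.up_succ, Term.up_zero, Term.rename]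
  rw [show Term.up (Term.up (Term.up τ)) = Term.up^[3] τ from rfl, stepBody_substp_up]

/-- **`Step` on an encoded configuration**, up to the dispatch: the stacks go through the delay
line and the program counter selects the branch of the current instruction.
[cite: GaboardiMarionRonchidellarocca2008, §3.2 (behaviour of `Dec`)] -/
theorem reduces_app_Step_dispatch (T : TCfg) (hT : T.SymOK NS nK) :
    Reduces (.app (Step NS nK FP) (encConf NS nK FP T))
      (.lam (.lam (((brInstr NS nK FP FP[min T.pc FP.length]?).apps
        ((List.range (nK + 1)).map fun i => dstT NS cvar (T.stk i)))))) := by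
  -- the outer β-step: `s := encConf T` (closed)
  have hβ := Red.beta (Term.lams 2 (Term.letT (nK + 2) ((Term.var 2).apps [F NS (.var 1), F NS (.var 0)])
    (stepBody NS nK FP))) (encConf NS nK FP T)
  rw [Term.subst0_eq_substp, Term.substp_lams] at hβ
  refine (Relation.ReflTransGen.single hβ).trans ?_
  simp only [Term.lams, Term.letT_substp, Term.substp_apps, List.map_cons, List.map_nil, F_substp, Term.substp]
  have e2 : (Term.up^[2] (Term.consSub (encConf NS nK FP T))) 2 = encConf NS nK FP T := by
    rw [Term.up_iterate_consSub]; simp [Term.rename_eq_substp, encConf_substp]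
  have e1 : (Term.up^[2] (Term.consSub (encConf NS nK FP T))) 1 = .var 1 := by
    rw [Term.up_iterate_consSub, if_pos (by omega)]
  have e0 : (Term.up^[2] (Term.consSub (encConf NS nK FP T))) 0 = .var 0 := by
    rw [Term.up_iterate_consSub, if_pos (by omega)]
  have eb := stepBody_substp_up (NS := NS) (nK := nK) (FP := FP)
  rw [e2, e1, e0, eb]
  refine Reduces.lam (Reduces.lam ?_)
  refine (reduces_step_phase1 T).trans ?_
  -- delay lines and dispatch
  have hd : List.Forall₂ Reduces
      ((List.range (nK + 1)).map fun i => Term.app (encStack NS (fun o => F NS (cvar o)) (T.stk i)) (initD NS))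
      ((List.range (nK + 1)).map fun i => dstT NS cvar (T.stk i)) := by
    refine List.forall₂_map_map fun i hi => ?_
    rw [List.mem_range] at hi
    exact (reduces_app_encStack _ _ _).trans (reduces_chain_F cvar (T.stk i) (hT i (by omega)))
  refine (Reduces.apps_args _ hd).trans ?_
  refine Reduces.apps ?_ _
  have := reduces_apps_oneHot (n := FP.length + 1) (i := min T.pc FP.length) (by omega) (BRS NS nK FP) length_BRS
  simp only [BRS, List.get_eq_getElem, List.getElem_map, List.getElem_range] at this
  exact this

/-! ### The branches at work -/

/-- `gotoBody_congr` (bookkeeping). [folklore] -/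
theorem gotoBody_congr {j : ℕ} {Dv Dv' : ℕ → Term} (h : ∀ i < nK + 1, Dv i = Dv' i) :
    gotoBody NS nK FP j Dv = gotoBody NS nK FP j Dv' := by
  unfold gotoBody
  congr 2
  exact List.map_congr_left fun i hi => by rw [h i (List.mem_range.1 hi)]

/-- `pushBody_congr` (bookkeeping). [folklore] -/
theorem pushBody_congr {k a j : ℕ} {Dv Dv' : ℕ → Term} (h : ∀ i < nK + 1, Dv i = Dv' i) (hk : k < nK + 1) (G Hh : Term) :
    pushBody NS nK FP k a j Dv G Hh = pushBody NS nK FP k a j Dv' G Hh := by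
  unfold pushBody
  congr 2
  exact List.map_congr_left fun i hi => by rw [h i (List.mem_range.1 hi), h k hk]

/-- `popBody_congr` (bookkeeping). [folklore] -/
theorem popBody_congr {k : ℕ} {t : List ℕ} {Dv Dv' : ℕ → Term} (h : ∀ i < nK + 1, Dv i = Dv' i) (G Iv : Term) :
    popBody NS nK FP k t Dv G Iv = popBody NS nK FP k t Dv' G Iv := by
  unfold popBody
  congr 2
  exact List.map_congr_left fun i hi => by rw [h i (List.mem_range.1 hi)]

variable (NS nK) in
/-- The decomposed stacks, as the spine arguments of a branch. [folklore] -/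
def Ds (T : TCfg) : List Term := (List.range (nK + 1)).map fun i => dstT NS cvar (T.stk i)

/-- `length_Ds` (bookkeeping). [folklore] -/
@[simp] theorem length_Ds (T : TCfg) : (Ds NS nK T).length = nK + 1 := by simp [Ds]

/-- `subL_eq_getElem` (bookkeeping). [folklore] -/
theorem _root_.Literature.Computability.ImplicitComplexity.STA.Term.subL_eq_getElem (Ms : List Term) {i : ℕ}
    (hi : i < Ms.length) : Term.subL Ms i = Ms[Ms.length - 1 - i]'(by omega) := by
  rw [Term.subL, dif_pos hi, List.get_eq_getElem]

/-- `subL_Ds` (bookkeeping). [folklore] -/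
theorem subL_Ds (T : TCfg) {i : ℕ} (hi : i < nK + 1) : Term.subL (Ds NS nK T) (nK - i) = dstT NS cvar (T.stk i) := by
  rw [Term.subL_eq_getElem _ (by rw [length_Ds]; omega)]
  simp only [Ds, List.getElem_map, List.getElem_range, List.length_map, List.length_range]
  congr 2
  omega

/-- `up3_subL_Ds` (bookkeeping). [folklore] -/
theorem up3_subL_Ds (T : TCfg) {i : ℕ} (hi : i < nK + 1) :
    (Term.up^[3] (Term.subL (Ds NS nK T))) (nK - i + 3) = (dstT NS cvar (T.stk i)).rename (· + 3) := by
  rw [Term.up_iterate_subL, if_neg (by omega), show nK - i + 3 - 3 = nK - i by omega, subL_Ds T hi]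

/-- **`goto`**: all stacks restored, new program counter. [cite: GaboardiMarionRonchidellarocca2008, §3.2 (`Com`)] -/
theorem reduces_brGoto (j : ℕ) (T : TCfg) (hT : T.SymOK NS nK) :
    Reduces ((brGoto NS nK FP j).apps (Ds NS nK T)) (bodyT NS nK FP cvar ⟨j, T.stk⟩) := by
  have h1 := reduces_apps_lams (nK + 1) (gotoBody NS nK FP j fun i => .var (nK - i)) (Ds NS nK T) (length_Ds T)
  refine h1.trans ?_
  rw [gotoBody_substp, show (gotoBody NS nK FP j fun i => Term.substp (Term.subL (Ds NS nK T)) (.var (nK - i))) =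
    gotoBody NS nK FP j (fun i => dstT NS cvar (T.stk i)) from gotoBody_congr fun i hi => subL_Ds T hi]
  refine Reduces.tuple (List.rel_append (List.forall₂_map_map fun i hi => ?_) (List.Forall₂.cons Relation.ReflTransGen.refl
    List.Forall₂.nil))
  exact reduces_restore cvar (T.stk i) (hT i (by simpa [Nat.lt_succ_iff] using List.mem_range.1 hi))

/-- A renamed restoration of a decomposed stack, applied to the bound variable of a new cell:
`(restore D)↑ z →* ` the cells over `z`. [folklore] -/
theorem reduces_restore_succ_var0 (cells : List (Bool × ℕ)) (hc : ∀ oa ∈ cells, oa.2 < NS) :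
    Reduces (.app ((restore NS (dstT NS cvar cells)).rename Nat.succ) (.var 0))
      (chain NS (fun o => (cvar o).rename Nat.succ) cells (.var 0)) := by
  refine (Reduces.appL ((reduces_restore cvar cells hc).rename Nat.succ) _).trans ?_
  rw [encStack_rename, encStack]
  have := Red.beta (chain NS (fun o => ((cvar o).rename Nat.succ).rename Nat.succ) cells (.var 0)) (.var 0)
  rw [chain_succ_subst0] at this
  exact Relation.ReflTransGen.single this

/-- **`push k a`** (`k < nK`, reservoir non-empty): the top reservoir cell's constructor builds
the new cell of stack `k`. [cite: GaboardiMarionRonchidellarocca2008, §3.2 (`Com`, "`c_r b' ∘ c_l b_l ∘ l`")] -/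
theorem reduces_brPush {k a j : ℕ} (hk : k < nK) (T : TCfg) (hT : T.SymOK NS nK) {o : Bool} {b : ℕ}
    {res : List (Bool × ℕ)} (hres : T.stk nK = (o, b) :: res) :
    Reduces ((brPush NS nK FP k a j).apps (Ds NS nK T)) (bodyT NS nK FP cvar ⟨j, pushRes nK T.stk k a⟩) := by
  have h1 := reduces_apps_lams (nK + 1)
    (Term.letT 3 (.var 0) (pushBody NS nK FP k a j (fun i => .var (nK - i + 3)) (.var 2) (.var 1))) (Ds NS nK T) (length_Ds T)
  refine h1.trans ?_
  rw [Term.letT_substp, pushBody_substp]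
  have e0 : Term.subL (Ds NS nK T) 0 = dstT NS cvar (T.stk nK) := by
    have := subL_Ds (NS := NS) (nK := nK) T (i := nK) (by omega); rwa [Nat.sub_self] at this
  simp only [Term.substp, e0, Term.up_iterate_var_lt _ (show 2 < 3 by omega), Term.up_iterate_var_lt _ (show 1 < 3 by omega)]
  rw [pushBody_congr (Dv' := fun i => (dstT NS cvar (T.stk i)).rename (· + 3)) (fun i hi => up3_subL_Ds T hi) (by omega),
    hres, dstT]
  -- the `let`
  have h2 := reduces_letT_tuple [encStack NS cvar res, cvar o, symT NS b]
    (pushBody NS nK FP k a j (fun i => (dstT NS cvar (T.stk i)).rename (· + 3)) (.var 2) (.var 1)) (n := 3) rfl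
  refine h2.trans ?_
  rw [pushBody_substp]
  have e2 : Term.subL [encStack NS cvar res, cvar o, symT NS b] 2 = encStack NS cvar res := by simp [Term.subL]
  have e1 : Term.subL [encStack NS cvar res, cvar o, symT NS b] 1 = cvar o := by simp [Term.subL]
  simp only [Term.substp, e2, e1]
  rw [show pushBody NS nK FP k a j (fun i => Term.substp (Term.subL [encStack NS cvar res, cvar o, symT NS b])
      (Term.rename (· + 3) (dstT NS cvar (T.stk i)))) (encStack NS cvar res) (cvar o) =
      pushBody NS nK FP k a j (fun i => dstT NS cvar (T.stk i)) (encStack NS cvar res) (cvar o) from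
    pushBody_congr (fun i _ => Term.substp_subL_rename_length _ _) (by omega) _ _]
  -- componentwise
  refine Reduces.tuple (List.rel_append (List.forall₂_map_map fun i hi => ?_)
    (List.Forall₂.cons Relation.ReflTransGen.refl List.Forall₂.nil))
  have hi' : i < nK + 1 := List.mem_range.1 hi
  have hnk : k ≠ nK := by omega
  by_cases hik : i = k
  · subst hik
    simp only [if_true, pushRes, hres, Function.update_of_ne hnk, Function.update_self]
    refine Reduces.lam (Reduces.appR _ ?_)
    exact reduces_restore_succ_var0 (T.stk i) (hT i (by omega))
  · by_cases hin : i = nK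
    · subst hin
      simp only [hik, if_false, if_true, pushRes, hres, Function.update_self]
      exact Relation.ReflTransGen.refl
    · simp only [hik, hin, if_false, pushRes, hres, Function.update_of_ne hin, Function.update_of_ne hik]
      exact reduces_restore cvar (T.stk i) (hT i (by omega))

/-- **`pop k`** (`k < nK`): stack `k` loses its top cell, the popped symbol selects the next
program counter in the table. [cite: GaboardiMarionRonchidellarocca2008, §3.2 (`Com`, `δ`)] -/
theorem reduces_brPop {k : ℕ} (t : List ℕ) (hk : k < nK) (T : TCfg) (hT : T.SymOK NS nK) :
    Reduces ((brPop NS nK FP k t).apps (Ds NS nK T))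
      (bodyT NS nK FP cvar ⟨t.getD (tblIdx ((T.stk k).head?.map Prod.snd)) 0, Function.update T.stk k (T.stk k).tail⟩) := by
  have h1 := reduces_apps_lams (nK + 1)
    (Term.letT 3 (.var (nK - k)) (popBody NS nK FP k t (fun i => .var (nK - i + 3)) (.var 2) (.var 0))) (Ds NS nK T) (length_Ds T)
  refine h1.trans ?_
  rw [Term.letT_substp, popBody_substp]
  simp only [Term.substp, subL_Ds T (show k < nK + 1 by omega), Term.up_iterate_var_lt _ (show 2 < 3 by omega),
    Term.up_iterate_var_lt _ (show 0 < 3 by omega)]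
  rw [popBody_congr (Dv' := fun i => (dstT NS cvar (T.stk i)).rename (· + 3)) (fun i hi => up3_subL_Ds T hi), dstT_eq]
  have h2 := reduces_letT_tuple [dstG NS cvar (T.stk k), dstH cvar (T.stk k), dstI NS (T.stk k)]
    (popBody NS nK FP k t (fun i => (dstT NS cvar (T.stk i)).rename (· + 3)) (.var 2) (.var 0)) (n := 3) rfl
  refine h2.trans ?_
  rw [popBody_substp]
  have e2 : Term.subL [dstG NS cvar (T.stk k), dstH cvar (T.stk k), dstI NS (T.stk k)] 2 = dstG NS cvar (T.stk k) := by
    simp [Term.subL]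
  have e0 : Term.subL [dstG NS cvar (T.stk k), dstH cvar (T.stk k), dstI NS (T.stk k)] 0 = dstI NS (T.stk k) := by
    simp [Term.subL]
  simp only [Term.substp, e2, e0]
  rw [show popBody NS nK FP k t (fun i => Term.substp (Term.subL [dstG NS cvar (T.stk k), dstH cvar (T.stk k), dstI NS (T.stk k)])
      (Term.rename (· + 3) (dstT NS cvar (T.stk i)))) (dstG NS cvar (T.stk k)) (dstI NS (T.stk k)) =
      popBody NS nK FP k t (fun i => dstT NS cvar (T.stk i)) (dstG NS cvar (T.stk k)) (dstI NS (T.stk k)) from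
    popBody_congr (fun i _ => Term.substp_subL_rename_length _ _) _ _]
  refine Reduces.tuple (List.rel_append (List.forall₂_map_map fun i hi => ?_) (List.Forall₂.cons ?_ List.Forall₂.nil))
  · have hi' : i < nK + 1 := List.mem_range.1 hi
    by_cases hik : i = k
    · subst hik
      simp only [if_true, Function.update_self]
      cases hS : T.stk i with
      | nil => exact Relation.ReflTransGen.refl
      | cons oa rest => exact Relation.ReflTransGen.refl
    · simp only [hik, if_false, Function.update_of_ne hik]
      exact reduces_restore cvar (T.stk i) (hT i (by omega))
  · -- the popped symbol reads the table
    have hlen : ((List.range (NS + 1)).map fun idx => pcT FP.length (t.getD idx 0)).length = NS + 1 := by simp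
    cases hS : T.stk k with
    | nil =>
      have := reduces_apps_oneHot (n := NS + 1) (i := 0) (by omega) _ hlen
      simpa [dstI, botT, tblIdx] using this
    | cons oa rest =>
      obtain ⟨o, b⟩ := oa
      have hb : b < NS := hT k (by omega) (o, b) (by simp [hS])
      have := reduces_apps_oneHot (n := NS + 1) (i := b + 1) (by omega) _ hlen
      simpa [dstI, symT, tblIdx] using this

/-- **One machine step**: `Step (encConf T) →β* encConf (stepT T)` (symbols `< NS`, reservoir
non-empty). [cite: GaboardiMarionRonchidellarocca2008, §3.2 (behaviour of `Tr`), Thm. 3.9] -/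
theorem reduces_app_Step (T : TCfg) (hT : T.SymOK NS nK) (hres : T.stk nK ≠ []) :
    Reduces (.app (Step NS nK FP) (encConf NS nK FP T)) (encConf NS nK FP (stepT nK FP T)) := by
  refine (reduces_app_Step_dispatch T hT).trans (Reduces.lam (Reduces.lam ?_))
  show Reduces ((brInstr NS nK FP FP[min T.pc FP.length]?).apps (Ds NS nK T)) (bodyT NS nK FP cvar (stepT nK FP T))
  unfold stepT
  by_cases hpc : FP.length ≤ T.pc
  · rw [Nat.min_eq_right hpc, List.getElem?_eq_none (le_refl _), List.getElem?_eq_none hpc]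
    simp only [brInstr]
    have := reduces_brGoto (FP := FP) FP.length T hT
    rwa [bodyT, ← pcT_of_le hpc] at this
  · rw [Nat.min_eq_left (by omega)]
    cases hI : FP[T.pc]? with
    | none => exact absurd (List.getElem?_eq_none_iff.1 hI) hpc
    | some instr =>
      rcases instr with ⟨j⟩ | ⟨k, a, j⟩ | ⟨k, t⟩ <;> simp only [brInstr]
      · exact reduces_brGoto j T hT
      · by_cases hk : k < nK
        · rw [if_pos hk, if_pos hk]
          obtain ⟨⟨o, b⟩, res, hS⟩ := List.exists_cons_of_ne_nil hres
          exact reduces_brPush hk T hT hS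
        · rw [if_neg hk, if_neg hk]
          exact reduces_brGoto j T hT
      · by_cases hk : k < nK
        · rw [if_pos hk, if_pos hk]
          exact reduces_brPop t hk T hT
        · rw [if_neg hk, if_neg hk]
          exact reduces_brGoto _ T hT

/-! ### Iterating the step -/

/-- Programs pushing only symbols `< NS` (a predicate on the number of symbols and the program).
[folklore] -/
def ProgSymOK (NS : ℕ) (FP : Prog) : Prop := ∀ pc k a j : ℕ, FP[pc]? = some (Instr.push k a j) → a < NS

/-- `length_pushRes_nK` (bookkeeping). [folklore] -/
theorem length_pushRes_nK (S : ℕ → List (Bool × ℕ)) (k a : ℕ) (_hk : k < nK) :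
    (S nK).length ≤ (pushRes nK S k a nK).length + 1 := by
  unfold pushRes
  cases hS : S nK with
  | nil => simp [hS]
  | cons oa res =>
    obtain ⟨o, b⟩ := oa
    simp [Function.update_self]

/-- One step takes at most one reservoir cell. [folklore] -/
theorem length_stepT_res (T : TCfg) : (T.stk nK).length ≤ ((stepT nK FP T).stk nK).length + 1 := by
  unfold stepT
  split
  · simp
  · simp
  · rename_i k a j _
    by_cases hk : k < nK
    · rw [if_pos hk]; exact length_pushRes_nK T.stk k a hk
    · rw [if_neg hk]; simp
  · rename_i k t _
    by_cases hk : k < nK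
    · rw [if_pos hk]; simp [Function.update_of_ne (show nK ≠ k by omega)]
    · rw [if_neg hk]; simp

/-- One step keeps the symbols `< NS`. [folklore] -/
theorem symOK_stepT (hFP : ProgSymOK NS FP) (T : TCfg) (hT : T.SymOK NS nK) : (stepT nK FP T).SymOK NS nK := by
  unfold stepT
  split
  · exact hT
  · exact hT
  · rename_i k a j hI
    by_cases hk : k < nK
    · rw [if_pos hk]
      intro i hi oa hoa
      simp only [pushRes] at hoa
      cases hS : T.stk nK with
      | nil => rw [hS] at hoa; exact hT i hi oa hoa
      | cons ob res =>
        obtain ⟨o, b⟩ := ob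
        rw [hS] at hoa
        simp only at hoa
        by_cases hin : i = nK
        · subst hin
          rw [Function.update_self] at hoa
          exact hT _ hi oa (by rw [hS]; exact List.mem_cons_of_mem _ hoa)
        · rw [Function.update_of_ne hin] at hoa
          by_cases hik : i = k
          · subst hik
            rw [Function.update_self] at hoa
            rcases List.mem_cons.1 hoa with rfl | hoa
            · exact hFP _ _ _ _ hI
            · exact hT i hi oa hoa
          · rw [Function.update_of_ne hik] at hoa
            exact hT i hi oa hoa
    · rw [if_neg hk]; exact hT
  · rename_i k t _
    by_cases hk : k < nK
    · rw [if_pos hk]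
      intro i hi oa hoa
      by_cases hik : i = k
      · subst hik
        simp only [Function.update_self] at hoa
        exact hT i hi oa (List.mem_of_mem_tail hoa)
      · simp only [Function.update_of_ne hik] at hoa
        exact hT i hi oa hoa
    · rw [if_neg hk]; exact hT

/-- **The run**: `n` steps, as long as the reservoir holds `n` cells.
[cite: GaboardiMarionRonchidellarocca2008, Thm. 3.9] -/
theorem reduces_iterApp_Step (hFP : ProgSymOK NS FP) :
    ∀ (n : ℕ) (T : TCfg), T.SymOK NS nK → n ≤ (T.stk nK).length →
      Reduces (iterApp (Step NS nK FP) (encConf NS nK FP T) n) (encConf NS nK FP ((stepT nK FP)^[n] T))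
  | 0, _, _, _ => Relation.ReflTransGen.refl
  | n + 1, T, hT, hn => by
    rw [iterApp, Function.iterate_succ_apply']
    -- the reservoir after `n` steps
    have hres : ∀ m ≤ n, m + ((stepT nK FP)^[m] T |>.stk nK).length ≥ (T.stk nK).length := by
      intro m hm
      induction m with
      | zero => simp
      | succ m ih =>
        have := length_stepT_res (nK := nK) (FP := FP) ((stepT nK FP)^[m] T)
        rw [Function.iterate_succ_apply']
        have := ih (by omega)
        omega
    have hsym : ∀ m, ((stepT nK FP)^[m] T).SymOK NS nK := by
      intro m
      induction m with
      | zero => exact hT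
      | succ m ih => rw [Function.iterate_succ_apply']; exact symOK_stepT hFP _ ih
    refine (Reduces.appR _ (reduces_iterApp_Step hFP n T hT (by omega))).trans ?_
    refine reduces_app_Step _ (hsym n) ?_
    have := hres n le_rfl
    intro h
    rw [h] at this
    simp at this
    omega

end Sim


end STA

end Literature.Computability.ImplicitComplexity
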